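import Summits.RiemannHypothesis.RiemannHypothesis.Theorems.Splittings.RobinFiniteOneFactCore
import Summits.RiemannHypothesis.RiemannHypothesis.Theorems.Splittings.RobinFiniteRefl
import HarnessLib

/-!
# RobinFiniteOneFactRefl — the reflection-paired pointwise Nicolas bound WITHOUT BKLNW (gen 17 «ONE PRINT FACT», reflected twin)

Cell rh-split, seat rh-split-robin-finite g17 (brief sha16 f79c5f09d8bcb036), card `cards/SPLIT-robin-finite.md` §24 (24.11/24.12).
Zero `def`, zero `instance`, zero `notation`, no attribute changes, no `native_decide`.

The tree's `RobinFiniteReflLow.partialNicolasBetween1_refl_of_tail / _tailFree / negLog_le_Eb_point_refl hB hK` (gen 14: the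
reflection-paired off-line charge `h·(√x + 1/√x)/2` fed into `partialNicolasBetween1_holds hB hK`, i.e. into the `c = 1` core
`corePwLower1 hB hK`) re-run over the BKLNW-free core `RobinFiniteOneFactCore.partialNicolasBetween1B_holds hB … (B ≤ 10³⁴)`:
the same three statements with the hypothesis `BroadbentEtAl2021_theta_rel_1e19` deleted and the binder `B ≤ 1e34` added
(every window top used downstream is `B = 10¹⁹`).  Consumers: the reflected √-window rows of lane (ix-k) (`RobinFiniteSqrtWindowRefl`,
`RobinFiniteSqrtWindowReflKernel`) once patched (`g17/patchR/`), giving `robinInequality_le_ten_pow_209600000` modulo {Büthe 2018 Thm 2}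
+ the tree's kernel certificate `riemannHypothesisUpTo_100000` only.

HONEST LABEL: «SPLITTING SEARCH over kernel-typed RH-EQUIVALENCES; a splitting A ∧ B ⟹ RH is CONDITIONAL bookkeeping unless A and B
are both proved; nothing here bears on the truth of RH.»
-/

set_option linter.dupNamespace false

noncomputable section

open Real Filter Finset
open scoped Chebyshev ComplexConjugate

namespace Summit.RiemannHypothesis.RiemannHypothesis.Theorems.Splittings.RobinFiniteC1

open Literature.NumberTheory.LFunctions Literature.NumberTheory.DiophantineGeometry
open RobinAnalyticSharp
open Summit.RiemannHypothesis.RiemannHypothesis.Theorems.Splittings.RobinFiniteE3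
open Summit.RiemannHypothesis.RiemannHypothesis.Theorems.Splittings.RobinFiniteTail (zeroTailBound_tailH tailH_nonneg)

section OneFactRefl

/-! ### O7 · the reflected (halved) pointwise chain over the BKLNW-free core -/

/-- **O7a · c = 1 · E1c⁻ ∧ (tail bound) ⟹ windowed E1, HALVED, without BKLNW**: a tail bound `Σ_{|γ|>T} m/γ² ≤ h` gives Nicolas's
lower bound with budget `0.0463 + (1 + 2/log X₀)·h·(√X₁ + 1/√X₁)/2` on `[X₀, X₁]`, `X₁ ≤ B ≤ 10³⁴`
(tree, with `hK` and no cap: `RobinFiniteReflLow.partialNicolasBetween1_refl_of_tail`). -/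
theorem partialNicolasBetween1B_refl_of_tail (hB : Buthe2018_thm2_theta)
    {T B h X₀ X₁ : ℝ}
    (ht : ∑' ρ : RHWave0.riemannZetaNontrivialZeros,
        (if T < |(ρ : ℂ).im| then (riemannZetaZeroOrder (ρ : ℂ) : ℝ) / (ρ : ℂ).im ^ 2 else 0) ≤ h)
    (hh : 0 ≤ h) (hX₀ : 1 < X₀) (hBB : X₁ ≤ B) (hB34 : B ≤ 1e34) :
    RiemannHypothesisUpTo T → (∀ y : ℝ, 599 ≤ y → y ≤ B → |θ y - y| ≤ √y * Real.log y ^ 2 / (8 * π)) →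
      ∀ x : ℝ, 599 ≤ x → X₀ ≤ x → x ≤ X₁ →
        -Real.log (nicolasF x) ≤ RobinAnalyticSharp.nicolasERH x +
            (0.0463 + (1 + 2 / Real.log X₀) * (h * ((√X₁ + (√X₁)⁻¹) / 2)) - nicolasBeta) *
              (1 / (√x * Real.log x) + 1 / (√x * Real.log x ^ 2) + 4 / (√x * Real.log x ^ 3)) := by
  refine partialNicolasBetween1B_holds hB (fun x hx0 hx1 => ?_) (by positivity) hX₀ hBB hB34
  have hx1' : 1 ≤ x := by linarith
  refine le_trans (offLineSumAt_refl_of_zeroTailBound ht hx1') (mul_le_mul_of_nonneg_left ?_ hh)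
  have hs1 : 1 ≤ √x := by rw [← Real.sqrt_one]; exact Real.sqrt_le_sqrt hx1'
  have hsX : √x ≤ √X₁ := Real.sqrt_le_sqrt hx1
  -- `u ↦ u + 1/u` is increasing on `[1, ∞)` (inlined; the tree's `ReflLow` helper is `private`, lane (ix-k)'s twin is `add_inv_mono_one`)
  have hmono : √x + (√x)⁻¹ ≤ √X₁ + (√X₁)⁻¹ := by
    have ha0 : 0 < √x := by linarith
    have hb0 : 0 < √X₁ := by linarith
    rw [← sub_nonneg]
    have e : √X₁ + (√X₁)⁻¹ - (√x + (√x)⁻¹) = (√X₁ - √x) * (1 - 1 / (√x * √X₁)) := by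
      field_simp
      ring
    rw [e]
    refine mul_nonneg (by linarith) ?_
    rw [sub_nonneg, div_le_one (mul_pos ha0 hb0)]
    nlinarith
  linarith

/-- **O7b · the same with the KERNEL's tail price `tailH(T)`** (∘ tree `RobinFiniteTail.zeroTailBound_tailH`), any `T ≥ 7`, `B ≤ 10³⁴`
(tree, with `hK`: `RobinFiniteReflLow.partialNicolasBetween1_refl_tailFree`). -/
theorem partialNicolasBetween1B_refl_tailFree (hB : Buthe2018_thm2_theta)
    {T B X₀ X₁ : ℝ} (hT : 7 ≤ T) (hX₀ : 1 < X₀) (hBB : X₁ ≤ B) (hB34 : B ≤ 1e34) :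
    RiemannHypothesisUpTo T → (∀ y : ℝ, 599 ≤ y → y ≤ B → |θ y - y| ≤ √y * Real.log y ^ 2 / (8 * π)) →
      ∀ x : ℝ, 599 ≤ x → X₀ ≤ x → x ≤ X₁ →
        -Real.log (nicolasF x) ≤ RobinAnalyticSharp.nicolasERH x +
            (0.0463 + (1 + 2 / Real.log X₀) *
              (((Real.log (T / (2 * π)) + 1) / (π * T) + (184 + 30 * Real.log T) / T ^ 2) * ((√X₁ + (√X₁)⁻¹) / 2)) - nicolasBeta) *
              (1 / (√x * Real.log x) + 1 / (√x * Real.log x ^ 2) + 4 / (√x * Real.log x ^ 3)) :=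
  partialNicolasBetween1B_refl_of_tail hB (zeroTailBound_tailH hT) (tailH_nonneg hT) hX₀ hBB hB34

/-- **O7c · the reflection-paired pointwise lower bound at height `T`, without BKLNW** (`599 ≤ P ≤ B ≤ 10³⁴`):
`−log f(P) ≤ Eb(0.0463 + (1 + 2/log P)·tailH(T)·(√P + 1/√P)/2)(P)` (tree, with `hK` and no cap: `negLog_le_Eb_point_refl`). -/
theorem negLog_le_Eb_point_reflB (hB : Buthe2018_thm2_theta)
    {T B P : ℝ} (hT : 7 ≤ T) (hRH : RiemannHypothesisUpTo T)
    (hW : ∀ y : ℝ, 599 ≤ y → y ≤ B → |θ y - y| ≤ √y * Real.log y ^ 2 / (8 * π))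
    (hP : 599 ≤ P) (hPB : P ≤ B) (hB34 : B ≤ 1e34) :
    -Real.log (nicolasF P) ≤ RobinAnalyticSharp.nicolasERH P +
        (0.0463 + (1 + 2 / Real.log P) *
          (((Real.log (T / (2 * π)) + 1) / (π * T) + (184 + 30 * Real.log T) / T ^ 2) * ((√P + (√P)⁻¹) / 2)) - nicolasBeta) *
          (1 / (√P * Real.log P) + 1 / (√P * Real.log P ^ 2) + 4 / (√P * Real.log P ^ 3)) :=
  partialNicolasBetween1B_refl_tailFree hB (X₀ := P) (X₁ := P) hT (by linarith) hPB hB34 hRH hW P hP le_rfl le_rfl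

/-- **O7d · the reflection-paired pointwise bound below `10¹⁹` from {Büthe 2018 Thm 2, RH(T)} ONLY** (window = gen 16's `thetaWindow_ofB`, cited from the tree via part 2 — typer repair ixl-a). -/
theorem negLog_le_Eb_point_refl_one (hB : Buthe2018_thm2_theta) {T P : ℝ} (hT : 7 ≤ T) (hRH : RiemannHypothesisUpTo T)
    (hP : 599 ≤ P) (hP19 : P ≤ (10 : ℝ) ^ 19) :
    -Real.log (nicolasF P) ≤ RobinAnalyticSharp.nicolasERH P +
        (0.0463 + (1 + 2 / Real.log P) *
          (((Real.log (T / (2 * π)) + 1) / (π * T) + (184 + 30 * Real.log T) / T ^ 2) * ((√P + (√P)⁻¹) / 2)) - nicolasBeta) *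
          (1 / (√P * Real.log P) + 1 / (√P * Real.log P ^ 2) + 4 / (√P * Real.log P ^ 3)) :=
  negLog_le_Eb_point_reflB hB hT hRH (thetaWindow_ofB hB) hP hP19 (by norm_num)

end OneFactRefl

/-- info: 'Summit.RiemannHypothesis.RiemannHypothesis.Theorems.Splittings.RobinFiniteC1.negLog_le_Eb_point_reflB' depends on axioms: [propext, Classical.choice, Quot.sound] -/
#guard_msgs (whitespace := lax) in
#print axioms Summit.RiemannHypothesis.RiemannHypothesis.Theorems.Splittings.RobinFiniteC1.negLog_le_Eb_point_reflB

/-- info: 'Summit.RiemannHypothesis.RiemannHypothesis.Theorems.Splittings.RobinFiniteC1.negLog_le_Eb_point_refl_one' depends on axioms: [propext, Classical.choice, Quot.sound] -/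
#guard_msgs (whitespace := lax) in
#print axioms Summit.RiemannHypothesis.RiemannHypothesis.Theorems.Splittings.RobinFiniteC1.negLog_le_Eb_point_refl_one

end Summit.RiemannHypothesis.RiemannHypothesis.Theorems.Splittings.RobinFiniteC1

end
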